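import Literature.NumberTheory.NumberFields.BhargavaQuinticSpaceKey
import Literature.NumberTheory.NumberFields.BhargavaQuinticSpaceSectionAlgebra
import HarnessLib

/-!
# Bhargava's quintic space: proof of `WrightYukie1992_orbit_bijective_etaleQuintic`

Sibling proof file of `BhargavaQuinticSpace.lean`: the named fact
`Literature.NumberTheory.NumberFields.BhargavaQuinticSpace.WrightYukie1992_orbit_bijective_etaleQuintic`
— for `k` of characteristic `0`, `A ↦ K(A)` induces a bijection between the
`GL₄(k) × GL₅(k)`-orbits of non-degenerate elements of `V(k) = k⁴ ⊗ ∧²k⁵` and the isomorphism classes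
of étale quintic `k`-algebras [Yukie1993, §0.4 Thm (0.4.2); WrightYukie1992; Bhargava2008, §2, §4] —
is DISCHARGED here: `WrightYukie1992_orbit_bijective_etaleQuintic_holds`.

The four clauses:

* (a) `K(A)` étale of degree `5`: Galois descent, `etale_and_finrank_of_isNondegenerate`
  (`BhargavaQuinticSpaceDescent.lean`);
* (b, ⟹) same orbit ⟹ `K(A) ≃ K(A')`: transport along `Z_{g•A} ≃ Z_A`,
  `nonempty_algEquiv_of_smul_eq` (`BhargavaQuinticSpaceOrbit.lean`);
* (b, ⟸) `K(A) ≃ K(A')` ⟹ same orbit: `exists_smul_eq_of_algEquiv` below — an isomorphism gives a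
  Galois-equivariant identification of the zero loci (`exists_equivariant_equiv_of_algEquiv`,
  via a generator of the monogenic étale algebra `K(A')` and point separation
  `eq_of_forall_apply_eq`), which is induced by a rational `g₄ ∈ GL₄(k)`
  (`exists_glFourProj_eq_of_equivariant`, `BhargavaQuinticSpaceFrames.lean`); then the KEY lemma
  `exists_smul_eq_of_geomZeroLocus_eq` (`BhargavaQuinticSpaceKey.lean`) applies;
* (c) every étale quintic algebra arises: the explicit section `A_f`,
  `exists_isNondegenerate_algEquiv_of_etale` (`BhargavaQuinticSpaceSectionAlgebra.lean`).

## References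

* M. Bhargava, *Higher composition laws IV*, Ann. of Math. 167 (2008), 53–94. [Bhargava2008]
* D. J. Wright, A. Yukie, *Prehomogeneous vector spaces and field extensions*, Invent. Math. 110
  (1992), 283–314. [WrightYukie1992]
* A. Yukie, *Shintani Zeta Functions*, LMS LNS 183, CUP (1993), §0.4, Thm (0.4.2). [Yukie1993]
-/

noncomputable section

open Matrix Polynomial
open scoped LinearAlgebra.Projectivization

namespace Literature.NumberTheory.NumberFields
namespace BhargavaQuinticSpace

universe u

/-! ### Functions of `K(A)` separate the points of `Z_A(k̄)` -/

section Separation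

variable (k : Type u) [Field k] [CharZero k]

/-- **Point separation.** Two points of `Z_A(k̄)` at which all functions of `K(A)` agree are equal
(indicator-like functions separate Galois orbits; within an orbit `σ p_ω ≠ σ' p_ω` forces
`σ⁻¹σ' ∉ Stab(p_ω) = Gal(k̄/k(p_ω))`, so some value `a ∈ k(p_ω)` has `σ a ≠ σ' a`). [folklore] -/
theorem eq_of_forall_apply_eq (x : BhargavaQuinticSpace k) (p p' : geomZeroLocus k x)
    (h : ∀ f : quinticAlgebraOf k x, (f : geomZeroLocus k x → AlgebraicClosure k) p =
      (f : geomZeroLocus k x → AlgebraicClosure k) p') : p = p' := by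
  classical
  let ρ := orbitReps k x
  by_cases hidx : OrbitReps.idx p' = OrbitReps.idx p
  · -- same orbit
    set ω := OrbitReps.idx p with hω
    have hall : ∀ α : ρ.fld ω, ρ.mover p (α : AlgebraicClosure k) = ρ.mover p' (α : AlgebraicClosure k) := by
      intro α
      let a : ∀ ω', ρ.fld ω' := fun ω' =>
        if hω' : ω' = ω then ⟨(α : AlgebraicClosure k), hω' ▸ α.2⟩ else 0
      have hf := h ⟨ρ.lift a, ρ.lift_mem a⟩
      change ρ.lift a p = ρ.lift a p' at hf
      have e1 : ρ.lift a p = ρ.mover p (α : AlgebraicClosure k) := by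
        change ρ.mover p ((a (OrbitReps.idx p) : ρ.fld (OrbitReps.idx p)) : AlgebraicClosure k) = _
        congr 1
        simp [a, ← hω]
      have e2 : ρ.lift a p' = ρ.mover p' (α : AlgebraicClosure k) := by
        change ρ.mover p' ((a (OrbitReps.idx p') : ρ.fld (OrbitReps.idx p')) : AlgebraicClosure k) = _
        congr 1
        simp [a, hidx]
      rw [e1, e2] at hf
      exact hf
    -- hence `(mover p)⁻¹ * mover p'` stabilises the representative
    have hstab : (ρ.mover p)⁻¹ * ρ.mover p' ∈
        MulAction.stabilizer (AlgebraicClosure k ≃ₐ[k] AlgebraicClosure k) (ρ.R ω) := by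
      rw [stabilizer_eq_fixingSubgroup, IntermediateField.mem_fixingSubgroup_iff]
      intro z hz
      rw [AlgEquiv.mul_apply]
      have := hall ⟨z, hz⟩
      simp only at this
      rw [← this]
      simp
    rw [MulAction.mem_stabilizer_iff, mul_smul, inv_smul_eq_iff] at hstab
    have hp : ρ.mover p • ρ.R ω = p := ρ.mover_smul p
    have hp' : ρ.mover p' • ρ.R ω = p' := by
      have := ρ.mover_smul p'
      rwa [hidx] at this
    rw [← hp, ← hp', hstab]
  · -- different orbits: an indicator function separates
    exfalso
    let a : ∀ ω', ρ.fld ω' := fun ω' => if ω' = OrbitReps.idx p then 1 else 0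
    have hf := h ⟨ρ.lift a, ρ.lift_mem a⟩
    change ρ.lift a p = ρ.lift a p' at hf
    have e1 : ρ.lift a p = 1 := by
      change ρ.mover p ((a (OrbitReps.idx p) : ρ.fld (OrbitReps.idx p)) : AlgebraicClosure k) = 1
      simp [a]
    have e2 : ρ.lift a p' = 0 := by
      change ρ.mover p' ((a (OrbitReps.idx p') : ρ.fld (OrbitReps.idx p')) : AlgebraicClosure k) = 0
      simp [a, hidx]
    rw [e1, e2] at hf
    exact one_ne_zero hf

/-! ### From an isomorphism of quintic algebras to an equivariant identification of zero loci -/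

omit [CharZero k] in
/-- The value map of a function of `K(A)` is Galois-equivariant. [folklore] -/
theorem apply_galSmul (x : BhargavaQuinticSpace k) (f : quinticAlgebraOf k x)
    (σ : AlgebraicClosure k ≃ₐ[k] AlgebraicClosure k) (p : geomZeroLocus k x) :
    (f : geomZeroLocus k x → AlgebraicClosure k) (σ • p) = σ ((f : geomZeroLocus k x → AlgebraicClosure k) p) :=
  f.2 σ p (σ • p) rfl

/-- If `K(A)` is generated by `u`, the values of `u` separate the points of `Z_A(k̄)`. [folklore] -/
theorem injective_apply_of_generator (x : BhargavaQuinticSpace k) (u : quinticAlgebraOf k x)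
    (hgen : ∀ z : quinticAlgebraOf k x, ∃ g : Polynomial k, z = Polynomial.aeval u g) :
    Function.Injective fun p : geomZeroLocus k x => (u : geomZeroLocus k x → AlgebraicClosure k) p := by
  intro p p' hpp'
  apply eq_of_forall_apply_eq k x p p'
  intro z
  obtain ⟨g, rfl⟩ := hgen z
  change evalPt k x p (Polynomial.aeval u g) = evalPt k x p' (Polynomial.aeval u g)
  rw [← Polynomial.aeval_algHom_apply, ← Polynomial.aeval_algHom_apply]
  change Polynomial.aeval ((u : geomZeroLocus k x → AlgebraicClosure k) p) g =
    Polynomial.aeval ((u : geomZeroLocus k x → AlgebraicClosure k) p') g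
  simp only at hpp'
  rw [hpp']

/-- **Isomorphism ⟹ equivariant identification of zero loci.** An isomorphism `K(A) ≃ₐ[k] K(A')`
of the quintic algebras of two non-degenerate elements induces a `Gal(k̄/k)`-equivariant bijection
`Z_A(k̄) ≃ Z_{A'}(k̄)` (transport a generator `u` of `K(A')`, monogenic by
`Literature.FieldTheory.Separability.exists_adjoinRoot_algEquiv_of_etale`, and match points by
the values of `u`, resp. of its image, in the five roots of its minimal equation).
[cite: Yukie1993, §0.4; Bhargava2008, §2 pp. 59–60] -/
theorem exists_equivariant_equiv_of_algEquiv {x y : BhargavaQuinticSpace k}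
    (hx : IsNondegenerate k x) (hy : IsNondegenerate k y)
    (e : quinticAlgebraOf k x ≃ₐ[k] quinticAlgebraOf k y) :
    ∃ β : geomZeroLocus k x ≃ geomZeroLocus k y,
      ∀ (σ : AlgebraicClosure k ≃ₐ[k] AlgebraicClosure k) (P : geomZeroLocus k x), β (σ • P) = σ • β P := by
  classical
  haveI : Algebra.Etale k (quinticAlgebraOf k y) := (etale_and_finrank_of_isNondegenerate k hy).1
  obtain ⟨f, -, hsep, hdeg, ⟨ε⟩⟩ :=
    Literature.FieldTheory.Separability.exists_adjoinRoot_algEquiv_of_etale k (quinticAlgebraOf k y)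
  rw [(etale_and_finrank_of_isNondegenerate k hy).2] at hdeg
  -- generators `u ∈ K(y)`, `T = e⁻¹ u ∈ K(x)`
  set u : quinticAlgebraOf k y := ε (AdjoinRoot.root f) with hu
  set T : quinticAlgebraOf k x := e.symm u with hT
  have hgen_u : ∀ z : quinticAlgebraOf k y, ∃ g : Polynomial k, z = Polynomial.aeval u g := by
    intro z
    obtain ⟨w, rfl⟩ := ε.surjective z
    induction w using AdjoinRoot.induction_on with
    | ih g => exact ⟨g, by rw [← AdjoinRoot.aeval_eq, ← Polynomial.aeval_algHom_apply]⟩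
  have hgen_T : ∀ z : quinticAlgebraOf k x, ∃ g : Polynomial k, z = Polynomial.aeval T g := by
    intro z
    obtain ⟨g, hg⟩ := hgen_u (e z)
    refine ⟨g, ?_⟩
    rw [← e.symm_apply_apply z, hg, ← Polynomial.aeval_algHom_apply e.symm u g]
  -- the value maps are injective
  have hinjX := injective_apply_of_generator k x T hgen_T
  have hinjY := injective_apply_of_generator k y u hgen_u
  -- and take values in the roots of `f`
  have hf0 : f ≠ 0 := by
    intro h0
    rw [h0, Polynomial.natDegree_zero] at hdeg
    exact absurd hdeg (by norm_num)
  have hfu : Polynomial.aeval u f = 0 := by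
    rw [hu, Polynomial.aeval_algHom_apply, AdjoinRoot.aeval_eq, AdjoinRoot.mk_self, map_zero]
  have hfT : Polynomial.aeval T f = 0 := by
    rw [hT, Polynomial.aeval_algHom_apply, hfu, map_zero]
  have hrootX : ∀ p : geomZeroLocus k x,
      (T : geomZeroLocus k x → AlgebraicClosure k) p ∈ f.rootSet (AlgebraicClosure k) := by
    intro p
    rw [Polynomial.mem_rootSet_of_ne hf0]
    have := Polynomial.aeval_algHom_apply (evalPt k x p) T f
    rw [hfT, map_zero] at this
    exact this
  have hrootY : ∀ q : geomZeroLocus k y,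
      (u : geomZeroLocus k y → AlgebraicClosure k) q ∈ f.rootSet (AlgebraicClosure k) := by
    intro q
    rw [Polynomial.mem_rootSet_of_ne hf0]
    have := Polynomial.aeval_algHom_apply (evalPt k y q) u f
    rw [hfu, map_zero] at this
    exact this
  -- counting: all three sets have five elements
  haveI : Fintype (geomZeroLocus k x) := hx.finite_geomZeroLocus.fintype
  haveI : Fintype (geomZeroLocus k y) := hy.finite_geomZeroLocus.fintype
  have hcx : Fintype.card (geomZeroLocus k x) = 5 := by
    rw [← Set.toFinset_card, ← Set.ncard_eq_toFinset_card', hx.2.1]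
  have hcy : Fintype.card (geomZeroLocus k y) = 5 := by
    rw [← Set.toFinset_card, ← Set.ncard_eq_toFinset_card', hy.2.1]
  have hcr : Fintype.card (f.rootSet (AlgebraicClosure k)) = 5 := by
    rw [Polynomial.card_rootSet_eq_natDegree hsep (IsAlgClosed.splits _), hdeg]
  let vX : geomZeroLocus k x → f.rootSet (AlgebraicClosure k) := fun p => ⟨_, hrootX p⟩
  let vY : geomZeroLocus k y → f.rootSet (AlgebraicClosure k) := fun q => ⟨_, hrootY q⟩
  have hbX : Function.Bijective vX := by
    rw [Fintype.bijective_iff_injective_and_card]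
    exact ⟨fun p p' h => hinjX (congrArg Subtype.val h), by rw [hcx, hcr]⟩
  have hbY : Function.Bijective vY := by
    rw [Fintype.bijective_iff_injective_and_card]
    exact ⟨fun q q' h => hinjY (congrArg Subtype.val h), by rw [hcy, hcr]⟩
  let β : geomZeroLocus k x ≃ geomZeroLocus k y :=
    (Equiv.ofBijective vX hbX).trans (Equiv.ofBijective vY hbY).symm
  have hβval : ∀ P : geomZeroLocus k x,
      (u : geomZeroLocus k y → AlgebraicClosure k) (β P) = (T : geomZeroLocus k x → AlgebraicClosure k) P := by
    intro P
    have := Equiv.apply_symm_apply (Equiv.ofBijective vY hbY) (Equiv.ofBijective vX hbX P)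
    exact congrArg Subtype.val this
  refine ⟨β, fun σ P => ?_⟩
  apply hinjY
  simp only
  rw [hβval, apply_galSmul, apply_galSmul, hβval]

/-! ### Part (b), direction ⟸, and the assembly of the fact -/

omit [CharZero k] in
/-- `glFourProj g` is injective. [folklore] -/
theorem glFourProj_injective (g : GL (Fin 4) k) : Function.Injective (glFourProj k g) := by
  intro P P' h
  rw [← glFourProj_inv_apply k g P, h, glFourProj_inv_apply]

/-- **Part (b), direction ⟸, of `WrightYukie1992_orbit_bijective_etaleQuintic`.** Non-degenerate
`A, A' ∈ V(k)` (`char k = 0`) with isomorphic quintic algebras `K(A) ≃ₐ[k] K(A')` lie in the same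
`GL₄(k) × GL₅(k)`-orbit: the isomorphism gives a Galois-equivariant identification of the zero loci
(`exists_equivariant_equiv_of_algEquiv`), realised by a rational `g₄ ∈ GL₄(k)`
(`exists_glFourProj_eq_of_equivariant`), so that `(g₄, 1) • A'` has the same zero locus as `A`, and
the KEY lemma `exists_smul_eq_of_geomZeroLocus_eq` applies. [cite: Yukie1993, §0.4 Thm (0.4.2), "if"] -/
theorem exists_smul_eq_of_algEquiv {x y : BhargavaQuinticSpace k}
    (hx : IsNondegenerate k x) (hy : IsNondegenerate k y)
    (e : quinticAlgebraOf k x ≃ₐ[k] quinticAlgebraOf k y) :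
    ∃ g : GL (Fin 4) k × GL (Fin 5) k, g • x = y := by
  obtain ⟨β, hβ⟩ := exists_equivariant_equiv_of_algEquiv k hx hy e
  obtain ⟨g₄, hg₄⟩ := exists_glFourProj_eq_of_equivariant k hx hy β hβ
  set z : BhargavaQuinticSpace k := ((g₄, (1 : GL (Fin 5) k)) : GL (Fin 4) k × GL (Fin 5) k) • y with hz
  have hZ : geomZeroLocus k z = geomZeroLocus k x := by
    ext P
    rw [hz, mem_geomZeroLocus_smul_iff]
    constructor
    · intro hP
      obtain ⟨P', hP'⟩ := β.surjective ⟨_, hP⟩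
      have h1 : glFourProj k g₄ P' = glFourProj k g₄ P := by
        rw [hg₄ P', hP']
      have h2 : (P' : ℙ (AlgebraicClosure k) (Fin 4 → AlgebraicClosure k)) = P :=
        glFourProj_injective k g₄ h1
      rw [← h2]
      exact P'.2
    · intro hP
      change glFourProj k g₄ ((⟨P, hP⟩ : geomZeroLocus k x) : ℙ (AlgebraicClosure k) (Fin 4 → AlgebraicClosure k)) ∈ _
      rw [hg₄ ⟨P, hP⟩]
      exact (β ⟨P, hP⟩).2
  have hzn : IsNondegenerate k z := by
    refine ⟨?_, by rw [hZ]; exact hx.2.1, by rw [hZ]; exact hx.2.2⟩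
    have hbc : baseChange k z =
        ((glBaseChange k g₄, (1 : GL (Fin 5) (AlgebraicClosure k))) :
          GL (Fin 4) (AlgebraicClosure k) × GL (Fin 5) (AlgebraicClosure k)) • baseChange k y := by
      rw [hz, baseChange_smul]
      simp [glBaseChange]
    rw [hbc]
    exact linearIndependent_subPfaffian_glFour_smul _ _ hy.1
  obtain ⟨g, hg⟩ := exists_smul_eq_of_geomZeroLocus_eq k hx hzn hZ.symm
  refine ⟨((g₄, (1 : GL (Fin 5) k)) : GL (Fin 4) k × GL (Fin 5) k)⁻¹ * g, ?_⟩
  rw [mul_smul, hg, hz, inv_smul_smul]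

/-- **Wright–Yukie / Bhargava, `V = 4 ⊗ ∧²5` over a field of characteristic `0`: PROVED.**
Non-degenerate `GL₄(k) × GL₅(k)`-orbits on `V(k)` correspond bijectively to isomorphism classes of
étale quintic `k`-algebras via `A ↦ K(A)`.  Assembled from: part (a) Galois descent
(`etale_and_finrank_of_isNondegenerate`), part (b) `⟹` transport (`nonempty_algEquiv_of_smul_eq`),
part (b) `⟸` the syzygy argument (`exists_smul_eq_of_algEquiv`), part (c) the explicit section
`A_f` (`exists_isNondegenerate_algEquiv_of_etale`).
[cite: Yukie1993, §0.4 Thm (0.4.2); WrightYukie1992; Bhargava2008, §2 p. 63 and §4 p. 70] -/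
theorem WrightYukie1992_orbit_bijective_etaleQuintic_holds : WrightYukie1992_orbit_bijective_etaleQuintic := by
  intro k _ _
  refine ⟨fun x hx => etale_and_finrank_of_isNondegenerate k hx, fun x y hx hy => ⟨?_, ?_⟩,
    fun L _ _ hL h5 => ?_⟩
  · rintro ⟨g, hg⟩
    exact nonempty_algEquiv_of_smul_eq k g hg
  · rintro ⟨e⟩
    exact exists_smul_eq_of_algEquiv k hx hy e
  · haveI := hL
    exact exists_isNondegenerate_algEquiv_of_etale k L h5

end Separation

end BhargavaQuinticSpace
end Literature.NumberTheory.NumberFields
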